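import Summits.MatrixMultiplication.MatrixMultiplication.Theorems.OutsiderSandwichLevelRate
import HarnessLib

/-!
# Singular subspaces have codimension two: `a(N, m) ≥ m·(1 + 2·4^{-N})`

Route `OutsiderSandwich` (decomposition cell `decomp-mm`, lens 4 «minimal counterexample /
extremal reduction», gen 28, addendum), support for the aside leaf `BlockOneIsMM`
(stmt-MatrixMultiplication-27147).

**Theorem** (`rate_law₂`).  For every `N ≥ 1`: `Amortised N B m ⟹ (4^N + 2)·m ≤ 4^N·B`; at level
two `9m ≤ 8·a(2,m)` (`level_two_rate₂`), so `a(2,9) ≥ 11` and `⟨10⟩ ⊠ C₁^{⊠2} ⋭ ⟨9⟩ ⊠ ⟨2,2,2⟩^{⊠2}`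
(`amortisedNumber_two_nine`, `not_amortised_two_10_9`) — the level-two improvement over the
`m + 1` floor now starts at `m = 9` (`OutsiderSandwichLevelRate`: `m = 17`).

The new input is the **codimension-two lemma** (`finrank_add_two_le`): a linear subspace
`V ≤ M_n(ℂ)` (`n ≥ 2`) none of whose elements is invertible has `dim V ≤ n² − 2`.  Proof without
determinants: if `dim V ≥ n² − 1` then `V + ℂ·E_{ij} = M_n` for some matrix unit `E_{ij} ∉ V`; for
`i ≠ j` the element `1 − cE_{ij} ∈ V` is invertible (inverse `1 + cE_{ij}`), and for `i = j` the
element `Z − cE_{ii} ∈ V`, `Z` the permutation matrix of a fixed-point-free permutation, is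
invertible (inverse `Z⁻¹ + Z⁻¹cE_{ii}Z⁻¹`, as `E_{ii}Z⁻¹E_{ii} = 0`).  Fed into the pair-space count
(`pairRank_add_four_le`: if some `π₁`-component is invertible then `π₂L = 0`, and symmetrically;
otherwise both projections are singular subspaces) this gives the core bound
`dim π₁L + dim π₂L ≤ 2n² − 4`, which at `n = 2` is already the sharp bound `4` of
`OutsiderSandwichCoreTwoByTwo`, and the level law `OutsiderSandwichLevelLaw.level_law` does the
rest.  (Dieudonné's `dim V ≤ n² − n` would give `a(N,m) ≥ m(1 + 2^{-N})`; Flanders–Meshulam's pair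
bound `n²` would give `3m ≤ 2B` at every level.)

## References
* D. Coppersmith, S. Winograd, *Matrix multiplication via arithmetic progressions*,
  J. Symbolic Comput. 9 (1990) 251–280, §7 (the coupled block `C₁`). [CoppersmithWinograd1990]
* P. Bürgisser, M. Clausen, M. A. Shokrollahi, *Algebraic Complexity Theory*, Springer (1997),
  §14.4, §17.1 (restriction, conciseness, substitution). [BurgisserClausenShokrollahi1997]
-/

noncomputable section
open scoped BigOperators Matrix
set_option linter.dupNamespace false
set_option autoImplicit false

namespace Summit.MatrixMultiplication.MatrixMultiplication.Theorems.OutsiderSandwichLevelRateTwo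

open Literature.Computability.AlgebraicComplexity
open Summit.MatrixMultiplication.MatrixMultiplication.Theorems.OutsiderSandwichNoTightExchange
open Summit.MatrixMultiplication.MatrixMultiplication.Theorems.OutsiderSandwichCoupling (coupling₁)
open Summit.MatrixMultiplication.MatrixMultiplication.Theorems.OutsiderSandwichAmortisedTable
open Summit.MatrixMultiplication.MatrixMultiplication.Theorems.OutsiderSandwichLevelLaw

/-! ## 1. Singular subspaces have codimension two -/

section Codim

variable {ρ : Type} [Fintype ρ] [DecidableEq ρ]

/-- If `V + ℂ·E_{ij} = M_n` then `V` contains an invertible matrix (given a fixed-point-free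
permutation of the index set). [cite: BurgisserClausenShokrollahi1997, §17.1] -/
theorem exists_mul_eq_one_mem (σ : Equiv.Perm ρ) (hσ : ∀ x, σ x ≠ x)
    (V : Submodule ℂ (Matrix ρ ρ ℂ)) (i j : ρ)
    (hV : V ⊔ Submodule.span ℂ {Matrix.single i j (1 : ℂ)} = ⊤) :
    ∃ A ∈ V, ∃ B : Matrix ρ ρ ℂ, A * B = 1 := by
  -- every matrix `Y` is `v + c E_{ij}` with `v ∈ V`
  have dec : ∀ Y : Matrix ρ ρ ℂ, ∃ v ∈ V, ∃ c : ℂ, v = Y - Matrix.single i j c := by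
    intro Y
    have hY : Y ∈ V ⊔ Submodule.span ℂ {Matrix.single i j (1 : ℂ)} := by
      rw [hV]; exact Submodule.mem_top
    obtain ⟨v, hv, z, hz, hvz⟩ := Submodule.mem_sup.1 hY
    obtain ⟨c, rfl⟩ := Submodule.mem_span_singleton.1 hz
    refine ⟨v, hv, c, ?_⟩
    rw [Matrix.smul_single, smul_eq_mul, mul_one] at hvz
    exact eq_sub_of_add_eq hvz
  by_cases hij : i = j
  · subst hij
    -- `Z − c E_{ii}` with `Z` a fixed-point-free permutation matrix
    let Z : Matrix ρ ρ ℂ := σ.toPEquiv.toMatrix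
    let Z' : Matrix ρ ρ ℂ := σ.symm.toPEquiv.toMatrix
    have hZZ' : Z * Z' = 1 := by
      simp only [Z, Z']
      rw [← PEquiv.toMatrix_trans, ← Equiv.toPEquiv_trans, Equiv.self_trans_symm,
        Equiv.toPEquiv_refl, PEquiv.toMatrix_refl]
    have hZ'ii : Z' i i = 0 := by
      simp only [Z']
      rw [PEquiv.toMatrix_apply, Equiv.toPEquiv_apply]
      have : σ.symm i ≠ i := fun h => hσ i (by simpa using (congrArg σ h).symm)
      simp [this]
    obtain ⟨v, hv, c, rfl⟩ := dec Z
    refine ⟨_, hv, Z' + Z' * Matrix.single i i c * Z', ?_⟩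
    have hSZS : Matrix.single i i c * Z' * Matrix.single i i c = 0 := by
      rw [Matrix.single_mul_mul_single, hZ'ii, mul_zero, zero_mul, Matrix.single_zero]
    have h1 : Z * (Z' + Z' * Matrix.single i i c * Z') = 1 + Matrix.single i i c * Z' := by
      rw [mul_add, hZZ', show Z * (Z' * Matrix.single i i c * Z') =
        Z * Z' * Matrix.single i i c * Z' by simp only [mul_assoc], hZZ', one_mul]
    have h2 : Matrix.single i i c * (Z' + Z' * Matrix.single i i c * Z') =
        Matrix.single i i c * Z' := by
      rw [mul_add, show Matrix.single i i c * (Z' * Matrix.single i i c * Z') =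
        Matrix.single i i c * Z' * Matrix.single i i c * Z' by simp only [mul_assoc], hSZS,
        zero_mul, add_zero]
    rw [sub_mul, h1, h2, add_sub_cancel_right]
  · -- `1 − c E_{ij}` is unipotent
    obtain ⟨v, hv, c, rfl⟩ := dec 1
    refine ⟨_, hv, 1 + Matrix.single i j c, ?_⟩
    have hSS : Matrix.single i j c * Matrix.single i j c = 0 :=
      Matrix.single_mul_single_of_ne c i j i (Ne.symm hij) c
    rw [sub_mul, one_mul, mul_add, mul_one, hSS, add_zero, add_sub_cancel_right]

/-- **Codimension two.**  A subspace of `M_n(ℂ)` (`n ≥ 2`) without invertible elements has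
`dim ≤ n² − 2`. [cite: BurgisserClausenShokrollahi1997, §17.1] -/
theorem finrank_add_two_le (σ : Equiv.Perm ρ) (hσ : ∀ x, σ x ≠ x)
    (V : Submodule ℂ (Matrix ρ ρ ℂ)) (hV : ∀ A ∈ V, ∀ B : Matrix ρ ρ ℂ, A * B ≠ 1) :
    Module.finrank ℂ V + 2 ≤ Fintype.card ρ ^ 2 := by
  have hM : Module.finrank ℂ (Matrix ρ ρ ℂ) = Fintype.card ρ ^ 2 := by
    rw [Module.finrank_matrix, Module.finrank_self, mul_one, sq]
  by_contra hlt
  -- some matrix unit is missing from `V`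
  obtain ⟨i, j, hij⟩ : ∃ i j, Matrix.single i j (1 : ℂ) ∉ V := by
    by_contra hall
    push Not at hall
    refine hV 1 ?_ 1 (mul_one 1)
    rw [Matrix.matrix_eq_sum_single (1 : Matrix ρ ρ ℂ)]
    refine Submodule.sum_mem _ fun a _ => Submodule.sum_mem _ fun b _ => ?_
    have e : Matrix.single a b ((1 : Matrix ρ ρ ℂ) a b) =
        ((1 : Matrix ρ ρ ℂ) a b) • Matrix.single a b (1 : ℂ) := by
      rw [Matrix.smul_single, smul_eq_mul, mul_one]
    rw [e]
    exact V.smul_mem _ (hall a b)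
  -- `V + ℂ E_{ij}` is everything, by dimension
  have hlt' : V < V ⊔ Submodule.span ℂ {Matrix.single i j (1 : ℂ)} :=
    SetLike.lt_iff_le_and_exists.2 ⟨le_sup_left, _,
      Submodule.mem_sup_right (Submodule.mem_span_singleton_self _), hij⟩
  have h1 := Submodule.finrank_lt_finrank_of_lt hlt'
  have h2 := Submodule.finrank_le (V ⊔ Submodule.span ℂ {Matrix.single i j (1 : ℂ)})
  rw [hM] at h2
  have htop : V ⊔ Submodule.span ℂ {Matrix.single i j (1 : ℂ)} = ⊤ :=
    Submodule.eq_top_of_finrank_eq (by rw [hM]; omega)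
  obtain ⟨A, hA, B, hAB⟩ := exists_mul_eq_one_mem σ hσ V i j htop
  exact hV A hA B hAB

end Codim

/-! ## 2. The core bound `2n² − 4` -/

section Core

variable {ρ : Type} [Fintype ρ] [DecidableEq ρ]

/-- **Core bound `2n² − 4`.**  For `n ≥ 2`, a space `L` of pairs of `n × n` matrices with
`V · Y = 0` on `L` has `dim π₁L + dim π₂L ≤ 2n² − 4` (sharp for `n = 2`).
[cite: BurgisserClausenShokrollahi1997, §17.1] -/
theorem pairRank_add_four_le (σ : Equiv.Perm ρ) (hσ : ∀ x, σ x ≠ x)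
    (hρ : 2 ≤ Fintype.card ρ) (L : Submodule ℂ (Matrix ρ ρ ℂ × Matrix ρ ρ ℂ))
    (hL : ∀ x ∈ L, x.1 * x.2 = 0) : pairRank ρ L + 4 ≤ 2 * Fintype.card ρ ^ 2 := by
  have hM : Module.finrank ℂ (Matrix ρ ρ ℂ) = Fintype.card ρ ^ 2 := by
    rw [Module.finrank_matrix, Module.finrank_self, mul_one, sq]
  have hsq : 4 ≤ Fintype.card ρ ^ 2 := by
    have e : 2 ^ 2 ≤ Fintype.card ρ ^ 2 := Nat.pow_le_pow_left hρ 2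
    simpa using e
  have hP := Submodule.finrank_le (L.map (LinearMap.fst ℂ (Matrix ρ ρ ℂ) (Matrix ρ ρ ℂ)))
  have hQ := Submodule.finrank_le (L.map (LinearMap.snd ℂ (Matrix ρ ρ ℂ) (Matrix ρ ρ ℂ)))
  rw [hM] at hP hQ
  unfold pairRank
  by_cases hI : ∃ x ∈ L, ∃ B : Matrix ρ ρ ℂ, x.1 * B = 1
  · -- an invertible first component kills the second projection
    obtain ⟨x, hx, B, hB⟩ := hI
    have hB' : B * x.1 = 1 := mul_eq_one_comm.1 hB
    have hx2 : x.2 = 0 := by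
      rw [← one_mul x.2, ← hB', mul_assoc, hL x hx, mul_zero]
    have hbot : L.map (LinearMap.snd ℂ (Matrix ρ ρ ℂ) (Matrix ρ ρ ℂ)) = ⊥ := by
      rw [Submodule.eq_bot_iff]
      intro y hy
      obtain ⟨z, hz, rfl⟩ := Submodule.mem_map.1 hy
      have e := hL (x + z) (L.add_mem hx hz)
      rw [Prod.fst_add, Prod.snd_add, hx2, zero_add, add_mul, hL z hz, add_zero] at e
      show z.2 = 0
      rw [← one_mul z.2, ← hB', mul_assoc, e, mul_zero]
    rw [hbot, finrank_bot]
    omega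
  · by_cases hII : ∃ x ∈ L, ∃ B : Matrix ρ ρ ℂ, x.2 * B = 1
    · obtain ⟨x, hx, B, hB⟩ := hII
      have hx1 : x.1 = 0 := by
        rw [← mul_one x.1, ← hB, ← mul_assoc, hL x hx, zero_mul]
      have hbot : L.map (LinearMap.fst ℂ (Matrix ρ ρ ℂ) (Matrix ρ ρ ℂ)) = ⊥ := by
        rw [Submodule.eq_bot_iff]
        intro y hy
        obtain ⟨z, hz, rfl⟩ := Submodule.mem_map.1 hy
        have e := hL (x + z) (L.add_mem hx hz)
        rw [Prod.fst_add, Prod.snd_add, hx1, zero_add, mul_add, hL z hz, add_zero] at e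
        show z.1 = 0
        rw [← mul_one z.1, ← hB, ← mul_assoc, e, zero_mul]
      rw [hbot, finrank_bot]
      omega
    · -- both projections are singular subspaces
      push Not at hI hII
      have h1 := finrank_add_two_le σ hσ (L.map (LinearMap.fst ℂ (Matrix ρ ρ ℂ) (Matrix ρ ρ ℂ)))
        fun A hA B hAB => by
          obtain ⟨x, hx, rfl⟩ := Submodule.mem_map.1 hA
          exact hI x hx B hAB
      have h2 := finrank_add_two_le σ hσ (L.map (LinearMap.snd ℂ (Matrix ρ ρ ℂ) (Matrix ρ ρ ℂ)))
        fun A hA B hAB => by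
          obtain ⟨x, hx, rfl⟩ := Submodule.mem_map.1 hA
          exact hII x hx B hAB
      omega

end Core

/-! ## 3. The format `2^N`: a fixed-point-free permutation and the rate law -/

/-- Flipping the first letter: a fixed-point-free permutation of `Fin N → Fin 2` (`N ≥ 1`).
[folklore] -/
def flipFirst {N : ℕ} (hN : 1 ≤ N) : Equiv.Perm (Fin N → Fin 2) :=
  Function.Involutive.toPerm (fun v => Function.update v ⟨0, hN⟩ (v ⟨0, hN⟩ + 1)) fun v => by
    funext i
    by_cases hi : i = ⟨0, hN⟩
    · subst hi
      simp only [Function.update_self]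
      generalize v ⟨0, hN⟩ = x
      revert x
      decide
    · simp only [Function.update_of_ne hi]

/-- `flipFirst` has no fixed point. [folklore] -/
theorem flipFirst_ne {N : ℕ} (hN : 1 ≤ N) (v : Fin N → Fin 2) : flipFirst hN v ≠ v := by
  intro h
  have e := congrFun h ⟨0, hN⟩
  simp only [flipFirst, Function.Involutive.coe_toPerm, Function.update_self] at e
  revert e
  generalize v ⟨0, hN⟩ = x
  revert x
  decide

/-- The core bound `2·4^N − 4` at format `2^N`. [cite: BurgisserClausenShokrollahi1997, §17.1] -/
theorem pairRank_le_cheap₂ {N : ℕ} (hN : 1 ≤ N)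
    (L : Submodule ℂ (Matrix (Fin N → Fin 2) (Fin N → Fin 2) ℂ ×
      Matrix (Fin N → Fin 2) (Fin N → Fin 2) ℂ))
    (hL : ∀ x ∈ L, x.1 * x.2 = 0) : pairRank (Fin N → Fin 2) L ≤ 2 * 4 ^ N - 4 := by
  have hcard : Fintype.card (Fin N → Fin 2) = 2 ^ N := by
    simp only [Fintype.card_fun, Fintype.card_fin]
  have hρ : 2 ≤ Fintype.card (Fin N → Fin 2) := by
    rw [hcard]
    exact le_trans (by norm_num) (Nat.pow_le_pow_right (by norm_num) hN)
  have h := pairRank_add_four_le (flipFirst hN) (flipFirst_ne hN) hρ L hL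
  have h4 : Fintype.card (Fin N → Fin 2) ^ 2 = 4 ^ N := by
    rw [hcard, ← pow_mul, mul_comm, pow_mul]; norm_num
  rw [h4] at h
  omega

/-- **Rate law, second rung**: `Amortised N B m ⟹ (4^N + 2)·m ≤ 4^N·B` (`N ≥ 1`).
[cite: CoppersmithWinograd1990, §7] -/
theorem rate_law₂ {N B m : ℕ} (hN : 1 ≤ N) (h : Amortised N B m) :
    (4 ^ N + 2) * m ≤ 4 ^ N * B := by
  have key := level_law hN (Equiv.refl _) (fun L hL => pairRank_le_cheap₂ hN L hL) h
  have hK : 4 ≤ 4 ^ N := le_trans (by norm_num) (Nat.pow_le_pow_right (by norm_num) hN)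
  have e : m * (2 * 4 ^ N - 4) + m * 4 = 2 * (m * 4 ^ N) := by
    rw [← Nat.mul_add, Nat.sub_add_cancel (by omega)]; ring
  have key' : 4 * (m * 4 ^ N) ≤ m * (2 * 4 ^ N - 4) + 2 * (B * 4 ^ N) := by
    simpa only [mul_assoc] using key
  rw [add_mul, mul_comm (4 ^ N) m, mul_comm (4 ^ N) B]
  omega

/-- `(4^N + 2)·m ≤ 4^N·a(N, m)`: the level-`N` rate is at least `1 + 2·4^{-N}`.
[cite: CoppersmithWinograd1990, §7] -/
theorem rate_amortisedNumber₂ {N : ℕ} (hN : 1 ≤ N) (m : ℕ) :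
    (4 ^ N + 2) * m ≤ 4 ^ N * amortisedNumber N m :=
  rate_law₂ hN (amortised_amortisedNumber N m)

/-- Level two: `9m ≤ 8·a(2, m)`. [cite: CoppersmithWinograd1990, §7] -/
theorem level_two_rate₂ (m : ℕ) : 9 * m ≤ 8 * amortisedNumber 2 m := by
  have h := rate_amortisedNumber₂ (by norm_num : 1 ≤ 2) m
  norm_num at h
  omega

/-- **`a(2,9) ≥ 11`**: `⟨10⟩ ⊠ C₁^{⊠2} ⋭ ⟨9⟩ ⊠ ⟨2,2,2⟩^{⊠2}`. [cite: CoppersmithWinograd1990, §7] -/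
theorem amortisedNumber_two_nine : 11 ≤ amortisedNumber 2 9 := by
  have h := level_two_rate₂ 9
  omega

/-- `⟨10⟩ ⊠ C₁^{⊠2} ⋭ ⟨9⟩ ⊠ ⟨2,2,2⟩^{⊠2}`. [cite: CoppersmithWinograd1990, §7] -/
theorem not_amortised_two_10_9 : ¬ Amortised 2 10 9 := fun h => by
  have e := rate_law₂ (by norm_num : 1 ≤ 2) h
  norm_num at e

end Summit.MatrixMultiplication.MatrixMultiplication.Theorems.OutsiderSandwichLevelRateTwo
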